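import Literature.MathematicalPhysics.QuantumFieldTheory.Balaban1983to89.T3UnitScaleTilt
import Literature.MathematicalPhysics.QuantumFieldTheory.Balaban1983to89.AveragingRT

/-!
# Route `SmallFieldWidening`, crux r3 `LargeFieldMassRefinementTail` (stmt-QuantumFields-22884), line `birth` v6 — THE SHIFT BOUND:
# a Gibbs tail is at most `exp(−β·Δ)` as soon as ONE Haar-preserving map lowers the Wilson action by `Δ` on the event, and the
# background-field left multiplications in a fixed (e.g. axial) frame ARE Haar-preserving
# (support file, leaf; lead seat `ym-line-sfw-p2` gen 23; the stub `stub_firstExitDeep` and the crux stay open)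

WHY.  The one open registered stub of the crux (v6, shared verbatim with crux stmt-QuantumFields-26243 `FirstExitWindowTailL`) asks for the
Gibbs mass of a FIRST EXIT from Bałaban's small-field window at an averaged height `j` to be `≤ C·β^N·exp(−c·p(g_{K−j})²)`, uniformly in the
run `K`.  The record of the line (Cruxes/…/INTEGRATION.md, gens 0–22) lists four mechanisms and why each dies at unbounded height:
chessboard ∕ reflection positivity (an energy–ENTROPY split: loses `e^{O(L^{3j})}` per cell), deterministic propagation (`(151L²)^j` against
`L^{j/2}`), concentration ∕ log-Sobolev (strong coupling only), global UV stability (free-energy level).  This file records, as kernel theorems,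
the reduction step of a FIFTH mechanism that has NO entropy loss at all — the Cameron–Martin ∕ exponential-tilting argument behind the
Gaussian tail bound `ℙ{X ≥ θ} ≤ exp(−θ²/2σ²)`, transplanted to the product Haar measure of lattice gauge theory:

* §1 `setLIntegral_le_of_transport`, ★ `gibbsMeasure_real_le_exp_of_actionDrop`, `gibbsK_real_le_exp_of_actionDrop` — **THE SHIFT BOUND**:
  if `Φ` preserves the product Haar measure `dU` and LOWERS the Wilson action by at least `Δ` at every configuration of an event `A`
  (`A(Φ U) + Δ ≤ A(U)` on `A`), then `Gibbs_β(A) ≤ exp(−βΔ)` for every `β ≥ 0` — no partition-function estimate, no cells, no union: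
  `∫_A e^{−βA(U)} ≤ e^{−βΔ} ∫_A e^{−βA(ΦU)} ≤ e^{−βΔ} ∫ e^{−βA} ∘ Φ = e^{−βΔ}·Z`.  In the Gaussian caricature (`A = ½|da|²`, `X = ⟨dh, da⟩`,
  `Φ = ` translation by `−(θ/|dh|²)·h`) this is exactly `exp(−βθ²/2|dh|²)`, i.e. the route's Gaussian rung (`…GaussianRung`) with the
  exponential instead of the Chebyshev tail.
* §2 ★★ `measurePreserving_mulLeft_triangular` — **THE ADMISSIBLE MAPS**: for ANY set `T` of bonds (think: a maximal tree) and any measurable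
  background `u(U) : bonds → G` that READS ONLY the `T`-variables of `U` and is `1` on `T`, the map `U ↦ (b ↦ u(U)(b)·U(b))` preserves `dU`
  EXACTLY (Fubini over `T ∕ Tᶜ` + left invariance of Haar bond by bond; Mathlib's `MeasurePreserving.skew_product`).  The instance the mechanism
  uses: `u(U)(b) = exp(−λ·Ad(k_{x(b)}(U)⁻¹) h_b)` with `k(U)` the axial gauge transformation of the tree `T` (a function of the tree variables
  only) and `h` a FIXED Lie-algebra one-form vanishing on `T` — the covariant shift «subtract the background `λh` in `U`'s own axial frame»;
  by gauge invariance the action of the shifted field is `A(e^{−λh}·U^{k(U)})`, so §1 reduces the first-exit tail to a DETERMINISTIC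
  inequality: `A(W) − A(e^{−λh}W) ≥ Δ` for every axial-gauge field `W` in the multi-scale small-field event with the height-`j` plaquette bad.
  `gibbsMeasure_real_le_exp_of_mulLeft_triangular` is §1 ∘ §2.

HONEST SCOPE (numbers in INTEGRATION.md g23; docfix v2 of the same day corrects v1's range claim).  The deterministic inequality is NOT proved
here, and for a FIXED shift in a fixed tree frame it is very likely FALSE on the whole event: (i) NEAR FIELD — the second-order term is
`½λ²Σ_q|(d_W h)_q|²` with the COVARIANT derivative; in an axial frame `|(d_W h)_q − (dh)_q| ≲ |W_b − 1|·|h|`, `|W_b − 1| ≲ r·θ(K)` at distance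
`r`, so within `O(L^{j})` of the plaquette the abelian value `½λ²|dh|² ≍ θ(K−j)²/L^{j}` (`β_K`-times which is `p(g_{K−j})²`) survives while
`L^{4j}θ(K)² ≲ 1`; (ii) FAR FIELD — the test form of a flux functional is a DIPOLE (`|h| ≍ L^{2j}/r²`, no compactly supported `h` has `d⋆dh =`
the loop current), the frame rotations grow like `r·θ(K)`, and the heights above `j` are FREE on a first-exit event, so the first-order remainder
`Σ_q ⟨[a_q, h_q], F_q⟩` over the `2L^{m+n+K−j}` coarse cells of the torus has no deterministic bound below `θ(K−j)` (crudely it is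
`≍ θ(K)²L^{2j}S²`, `S` the torus side) and oscillating far fields inside the event can make it negative — bounding it is a tail estimate at the FREE
heights, i.e. an induction from the top height down; (iii) TOP HEIGHTS — there the diamagnetic excess `Σ_q|[A, h]|² ≍ θ(K)²L^{3j} ≫ |dh|² ≍ L^{j}`
in EVERY gauge once `L^{2j} ≳ β_K/p²`; the missing diamagnetic–paramagnetic cancellation is the one-loop Ward identity, i.e. Bałaban's
renormalisation group ([Balaban1985UV3] (41)/(71)).  So this mechanism, like the other four, does not reach the crux or even a height range on its
own; it is recorded because the REDUCTION is exact, entropy-free and reusable (crux 26243 shares the stub; any future Haar-preserving `Φ`, e.g. a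
field-dependent covariant one, plugs into §1/§4), and because it was absent from the line's record.  Conditional on nothing, credits nothing:
`stub_firstExitDeep`, crux r3 and route `SmallFieldWidening` stay OPEN; no summit is proved (rung R3 RECORD label; the Yang–Mills mass gap is NOT
touched by any of this).

References: T. Bałaban, Commun. Math. Phys. **102** (1985) 255–275 [Balaban1985UV3] ((1)–(3) p.256, (7) p.257, (71) p.273); CMP **98** (1985)
17–51 [Balaban1985Averaging] ((10) p.19: the product Haar measure `dU`).
-/

noncomputable section

open MeasureTheory
open scoped ENNReal
open Literature.MathematicalPhysics.QuantumFieldTheory.Balaban1983to89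
open Literature.MathematicalPhysics.QuantumFieldTheory.Balaban1983to89.Missing
open Literature.MathematicalPhysics.QuantumFieldTheory.Balaban1983to89.T3ContinuumYM3Torus
open Literature.MathematicalPhysics.QuantumFieldTheory.Balaban1983to89.T3UnitScaleTilt
open Literature.MathematicalPhysics.QuantumFieldTheory.Balaban1983to89.T4Continuum (measurable_iter)

namespace Summit.QuantumFields.YangMills.Theorems.LargeFieldMassRefinementTailShiftBound

/-! ## §1 The shift bound: a measure-preserving, action-lowering map bounds the Gibbs mass by `exp(−βΔ)` -/

section Abstract

variable {X : Type*} [MeasurableSpace X]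

/-- **TRANSPORT INEQUALITY** (the abstract Cameron–Martin step): if `Φ` preserves `μ` and the weight satisfies `w ≤ c·(w ∘ Φ)` on a
measurable set `A`, then `∫_A w dμ ≤ c·∫ w dμ` — the set `A` is simply dropped after the transport, which is where NOTHING is lost when
`c` is the sharp action cost. [folklore] -/
theorem setLIntegral_le_of_transport (μ : Measure X) {Φ : X → X} (hΦ : MeasurePreserving Φ μ μ)
    {w : X → ℝ≥0∞} (hw : Measurable w) {A : Set X} (hA : MeasurableSet A) (c : ℝ≥0∞)
    (hdrop : ∀ x ∈ A, w x ≤ c * w (Φ x)) :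
    ∫⁻ x in A, w x ∂μ ≤ c * ∫⁻ x, w x ∂μ :=
  calc ∫⁻ x in A, w x ∂μ ≤ ∫⁻ x in A, c * w (Φ x) ∂μ := setLIntegral_mono' hA hdrop
    _ ≤ ∫⁻ x, c * w (Φ x) ∂μ := setLIntegral_le_lintegral _ _
    _ = c * ∫⁻ x, w (Φ x) ∂μ := lintegral_const_mul c (hw.comp hΦ.measurable)
    _ = c * ∫⁻ y, w y ∂(μ.map Φ) := by rw [lintegral_map hw hΦ.measurable]
    _ = c * ∫⁻ y, w y ∂μ := by rw [hΦ.map_eq]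

/-- **NORMALISED FORM**: for the probability measure `(∫w)⁻¹·(w·μ)` the transport inequality reads `ℙ(A) ≤ c` (`0 < ∫ w < ∞`). [folklore] -/
theorem withDensity_real_le_of_transport (μ : Measure X) {Φ : X → X} (hΦ : MeasurePreserving Φ μ μ)
    {w : X → ℝ≥0∞} (hw : Measurable w) (hZ0 : ∫⁻ x, w x ∂μ ≠ 0) (hZ : ∫⁻ x, w x ∂μ ≠ ∞)
    {A : Set X} (hA : MeasurableSet A) {c : ℝ} (hc : 0 ≤ c)
    (hdrop : ∀ x ∈ A, w x ≤ ENNReal.ofReal c * w (Φ x)) :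
    ((∫⁻ x, w x ∂μ)⁻¹ • μ.withDensity w).real A ≤ c := by
  rw [measureReal_def, Measure.smul_apply, withDensity_apply _ hA, smul_eq_mul]
  refine ENNReal.toReal_le_of_le_ofReal hc ?_
  calc (∫⁻ x, w x ∂μ)⁻¹ * ∫⁻ x in A, w x ∂μ
      ≤ (∫⁻ x, w x ∂μ)⁻¹ * (ENNReal.ofReal c * ∫⁻ x, w x ∂μ) := by
        gcongr
        exact setLIntegral_le_of_transport μ hΦ hw hA _ hdrop
    _ = ENNReal.ofReal c := by
        rw [mul_comm (ENNReal.ofReal c), ← mul_assoc, ENNReal.inv_mul_cancel hZ0 hZ, one_mul]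

end Abstract

/-! ## §1b The shift bound for the Wilson–Gibbs measure of the tree (`T4GenFunBounds.gibbsMeasure`, `T3UnitScaleTilt.gibbsK`) -/

section Gibbs

variable {G : Type*} [GaugeGroup G] [MeasurableSpace G] [RegularGaugeGroup G] [HaarData G]

/-- ★ **THE SHIFT BOUND FOR THE WILSON–GIBBS MEASURE.**  If a map `Φ` of fine gauge fields preserves the product Haar measure `dU` and lowers
the unit-weight Wilson action `A(U) = Σ_p (1 − Re tr U(∂p))` by at least `Δ` at every field of a measurable event `A`, then
`Gibbs_β(A) ≤ exp(−βΔ)` for every `β ≥ 0`: `Z·Gibbs_β(A) = ∫_A e^{−βA} dU ≤ e^{−βΔ}∫_A e^{−βA∘Φ} dU ≤ e^{−βΔ}∫ e^{−βA} d(Φ_*dU) = e^{−βΔ}·Z`.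
The exponential-tilting (Cameron–Martin) mechanism for large-field tails, with no entropy term. [cite: Balaban1985UV3, (1)-(3) p.256] -/
theorem gibbsMeasure_real_le_exp_of_actionDrop (P : Params) {β Δ : ℝ} (hβ : 0 ≤ β)
    {Φ : GaugeField P 0 G → GaugeField P 0 G} (hΦ : MeasurePreserving Φ (fieldMeasure P 0 G) (fieldMeasure P 0 G))
    {A : Set (GaugeField P 0 G)} (hA : MeasurableSet A)
    (hdrop : ∀ U ∈ A, wilsonAction4 (Φ U) + Δ ≤ wilsonAction4 U) :
    (T4GenFunBounds.gibbsMeasure (G := G) P β).real A ≤ Real.exp (-(β * Δ)) := by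
  have hZpos := partitionFn_pos' (G := G) P hβ
  have hlint := T4GenFunBounds.lintegral_boltzmann (G := G) P hβ
  rw [T4GenFunBounds.gibbsMeasure, ← hlint]
  refine withDensity_real_le_of_transport (fieldMeasure P 0 G) hΦ (T4GenFunBounds.measurable_ofReal_boltzmann P β)
    ?_ ?_ hA (Real.exp_pos _).le fun U hU => ?_
  · rw [hlint]; exact (ENNReal.ofReal_pos.mpr hZpos).ne'
  · rw [hlint]; exact ENNReal.ofReal_ne_top
  · -- `e^{−βA(U)} ≤ e^{−βΔ}·e^{−βA(ΦU)}` from `A(ΦU) + Δ ≤ A(U)` and `β ≥ 0`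
    rw [← ENNReal.ofReal_mul (Real.exp_pos _).le]
    refine ENNReal.ofReal_le_ofReal ?_
    simp only [boltzmann]
    rw [← Real.exp_add]
    exact Real.exp_le_exp.mpr (by nlinarith [hdrop U hU])

/-- **THE SHIFT BOUND FOR RUN `K` OF A BAŁABAN FAMILY** (`gibbsK F ℰ γ K` = the Wilson–Gibbs law at `β_K = (γ ε_K)⁻¹`): an action drop `Δ` on
the event under a `dU`-preserving map gives Gibbs mass `≤ exp(−β_K·Δ)`; with `Δ = c·θ(K−j)²·L^{−j}` this is `exp(−c·p(g_{K−j})²)` exactly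
(`β_K θ(K−j)² = L^{j} p(g_{K−j})²`), the currency of the stub `stub_firstExitDeep`. [cite: Balaban1985UV3, (7) p.257 and (71) p.273] -/
theorem gibbsK_real_le_exp_of_actionDrop (F : T3Family) (ℰ : LoopAverage G) {γ Δ : ℝ} (hγ : 0 ≤ γ) (K : ℕ)
    {Φ : GaugeField (F.P K) 0 G → GaugeField (F.P K) 0 G}
    (hΦ : MeasurePreserving Φ (fieldMeasure (F.P K) 0 G) (fieldMeasure (F.P K) 0 G))
    {A : Set (GaugeField (F.P K) 0 G)} (hA : MeasurableSet A)
    (hdrop : ∀ U ∈ A, wilsonAction4 (Φ U) + Δ ≤ wilsonAction4 U) :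
    (gibbsK F ℰ γ K).real A ≤ Real.exp (-((F.scheme ℰ γ).β K * Δ)) :=
  gibbsMeasure_real_le_exp_of_actionDrop (F.P K) (F.scheme_β_nonneg ℰ hγ K) hΦ hA hdrop

end Gibbs

/-! ## §2 The admissible maps: background left-multiplications reading only a fixed set of bonds preserve `dU` -/

section Triangular

variable {P : Params} {j : ℕ} {G : Type*} [GaugeGroup G] [MeasurableSpace G] [HaarData G] [MeasurableMul₂ G]

/-- ★★ **TRIANGULAR LEFT MULTIPLICATION PRESERVES THE PRODUCT HAAR MEASURE.**  Let `T` be any set of bonds and `u : (fields) → (bonds → G)`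
a measurable background that reads only the `T`-variables (`U = U'` on `T` ⟹ `u U = u U'`) and equals `1` on `T`.  Then
`U ↦ (b ↦ u(U)(b)·U(b))` preserves `dU = Π_b dU(b)`: conditionally on the `T`-variables (which the map fixes), every other bond variable is
left-multiplied by a constant — Fubini over `T ∕ Tᶜ` (`measurePreserving_piEquivPiSubtypeProd`) and left invariance of Haar bond by bond
(`MeasurePreserving.skew_product`).  With `T` a maximal tree, `k(U)` its axial gauge transformation and `u(U)(b) = exp(−λ·Ad(k_{x(b)}(U)⁻¹)h_b)`
for a fixed one-form `h` vanishing on `T`, this is the covariant background shift `U ↦ (e^{−λh}·U^{k(U)})^{k(U)⁻¹}` of the Cameron–Martin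
mechanism. [cite: Balaban1985Averaging, (10) p.19] -/
theorem measurePreserving_mulLeft_triangular (T : Set (PBond P j)) [DecidablePred (· ∈ T)]
    (u : GaugeField P j G → PBond P j → G) (hum : Measurable u)
    (hread : ∀ U U' : GaugeField P j G, (∀ b ∈ T, U b = U' b) → u U = u U')
    (hone : ∀ (U : GaugeField P j G), ∀ b ∈ T, u U b = 1) :
    MeasurePreserving (fun (U : GaugeField P j G) (b : PBond P j) => u U b * U b) (fieldMeasure P j G) (fieldMeasure P j G) := by
  classical
  set p : PBond P j → Prop := fun b => b ∈ T with hp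
  set π : Measure (GaugeField P j G) := fieldMeasure P j G with hπ
  set π₀ := Measure.pi fun _ : {b : PBond P j // p b} => (HaarData.haar : Measure G) with hπ₀
  set π₁ := Measure.pi fun _ : {b : PBond P j // ¬ p b} => (HaarData.haar : Measure G) with hπ₁
  set e₀ := MeasurableEquiv.piEquivPiSubtypeProd (fun _ : PBond P j => G) p with he₀
  have hmp : MeasurePreserving e₀ π (π₀.prod π₁) := by
    simp only [hπ, fieldMeasure]
    exact measurePreserving_piEquivPiSubtypeProd (fun _ : PBond P j => (HaarData.haar : Measure G)) p
  -- the background as a function of the `T`-part only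
  set c : ({b : PBond P j // p b} → G) → PBond P j → G := fun t => u (e₀.symm (t, fun _ => 1)) with hc
  have hcu : ∀ U : GaugeField P j G, u U = c (e₀ U).1 := by
    intro U
    refine hread _ _ fun b hb => ?_
    have hpb : p b := hb
    simp [he₀, MeasurableEquiv.piEquivPiSubtypeProd, Equiv.piEquivPiSubtypeProd, hpb]
  have hcm : Measurable c :=
    hum.comp (e₀.symm.measurable.comp (measurable_id.prodMk measurable_const))
  -- the conditional left translation of the free part
  set Kf : ({b : PBond P j // p b} → G) → ({b : PBond P j // ¬ p b} → G) → ({b : PBond P j // ¬ p b} → G) :=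
    fun t w b => c t b.1 * w b with hKf
  have hKpres : ∀ t, MeasurePreserving (Kf t) π₁ π₁ := fun t =>
    measurePreserving_pi _ _ fun b => ⟨measurable_const_mul (c t b.1), HaarData.map_mul_left (c t b.1)⟩
  have hKmeas : Measurable (Function.uncurry Kf) := by
    refine measurable_pi_lambda _ fun b => ?_
    exact ((measurable_pi_apply b.1).comp (hcm.comp measurable_fst)).mul ((measurable_pi_apply b).comp measurable_snd)
  have hskew : MeasurePreserving (fun q : _ × _ => (q.1, Kf q.1 q.2)) (π₀.prod π₁) (π₀.prod π₁) :=
    (MeasurePreserving.id π₀).skew_product hKmeas (Filter.Eventually.of_forall fun t => (hKpres t).map_eq)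
  -- the map is `e₀⁻¹ ∘ skew ∘ e₀`
  have hfact : (fun (U : GaugeField P j G) (b : PBond P j) => u U b * U b) =
      e₀.symm ∘ (fun q : _ × _ => (q.1, Kf q.1 q.2)) ∘ e₀ := by
    funext U
    apply e₀.injective
    rw [Function.comp_apply, Function.comp_apply, e₀.apply_symm_apply]
    ext b
    · -- `T`-component: unchanged since `u U b = 1`
      simp [he₀, MeasurableEquiv.piEquivPiSubtypeProd, Equiv.piEquivPiSubtypeProd, hone U b.1 b.2]
    · simp [hKf, hcu U, he₀, MeasurableEquiv.piEquivPiSubtypeProd, Equiv.piEquivPiSubtypeProd]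
  rw [hfact]
  exact hmp.symm.comp (hskew.comp hmp)

end Triangular

/-! ## §3 The two halves together: a triangular background multiplication that lowers the action on the event bounds its Gibbs mass -/

section Together

variable {G : Type*} [GaugeGroup G] [MeasurableSpace G] [RegularGaugeGroup G] [HaarData G]

/-- **§1 ∘ §2**: if a background `u` reading only the bonds of `T` (and trivial on `T`) lowers the Wilson action by `Δ` on a measurable event
`A` when left-multiplied onto the field, then `Gibbs_β(A) ≤ exp(−βΔ)` (`β ≥ 0`) — the typed target of the covariant-shift mechanism: what
remains for a first-exit tail is the DETERMINISTIC action-drop inequality on the event. [cite: Balaban1985UV3, (1)-(3) p.256] -/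
theorem gibbsMeasure_real_le_exp_of_mulLeft_triangular (P : Params) {β Δ : ℝ} (hβ : 0 ≤ β)
    (T : Set (PBond P 0)) [DecidablePred (· ∈ T)]
    (u : GaugeField P 0 G → PBond P 0 → G) (hum : Measurable u)
    (hread : ∀ U U' : GaugeField P 0 G, (∀ b ∈ T, U b = U' b) → u U = u U')
    (hone : ∀ (U : GaugeField P 0 G), ∀ b ∈ T, u U b = 1)
    {A : Set (GaugeField P 0 G)} (hA : MeasurableSet A)
    (hdrop : ∀ U ∈ A, wilsonAction4 (P := P) (j := 0) (fun b => u U b * U b) + Δ ≤ wilsonAction4 U) :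
    (T4GenFunBounds.gibbsMeasure (G := G) P β).real A ≤ Real.exp (-(β * Δ)) :=
  gibbsMeasure_real_le_exp_of_actionDrop P hβ (measurePreserving_mulLeft_triangular T u hum hread hone) hA hdrop

end Together

/-! ## §4 The registered stub `stub_firstExitDeep` BY SHAPE from a deterministic action-drop family (the mechanism's exact target) -/

section Stub

open Literature.MathematicalPhysics.QuantumFieldTheory.Balaban1983to89.T3UnitLawDensityEML (ℰp measurableE_ℰp)

/-- The first-exit event of the stub (all finer averaged fields `θ_{b₀}`-small, the height-`j` field `θ_{b₂}`-small, the height-`j` plaquette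
`p` at least `θ_{b₀}(K−j)` from `1`) is measurable. [cite: Balaban1985UV3, (7) p.257] -/
theorem measurableSet_firstExitEvent (F : T3Family) (γ b₀ p₀ b₂ : ℝ) (K j : ℕ) (p : Plaq (F.P K) j) :
    MeasurableSet {U : GaugeField (F.P K) 0 (Matrix.specialUnitaryGroup (Fin 2) ℂ) |
      (∀ k, k < j → PlaqSmall (θBal F.L γ b₀ p₀ (K - k))
        (Averaging.iter (fun i => BlockAveraging.blockAvg (P := F.P K) (j := i) ℰp) k U)) ∧
      PlaqSmall (θBal F.L γ b₂ p₀ (K - j)) (Averaging.iter (fun i => BlockAveraging.blockAvg (P := F.P K) (j := i) ℰp) j U) ∧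
      θBal F.L γ b₀ p₀ (K - j) ≤ GaugeGroup.dist1 (GaugeField.plaqHol
        (Averaging.iter (fun i => BlockAveraging.blockAvg (P := F.P K) (j := i) ℰp) j U) p)} := by
  have hav := F.avgMeasurable_of_measurableE ℰp measurableE_ℰp K
  have hit : ∀ k, Measurable (Averaging.iter (fun i => BlockAveraging.blockAvg (P := F.P K) (j := i) ℰp) k) :=
    measurable_iter _ hav
  simp only [Set.setOf_and]
  refine MeasurableSet.inter ?_ (MeasurableSet.inter ?_ ?_)
  · rw [Set.setOf_forall]
    refine MeasurableSet.iInter fun k => ?_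
    by_cases hk : k < j
    · simp only [hk, forall_true_left]
      exact hit k (measurableSet_plaqSmall _)
    · simp only [hk, IsEmpty.forall_iff, Set.setOf_true, MeasurableSet.univ]
  · exact hit j (measurableSet_plaqSmall _)
  · exact measurableSet_le measurable_const
      ((RegularGaugeGroup.measurable_dist1.comp (measurable_plaqHol p)).comp (hit j))

/-- ★★ **THE DEEP FIRST-EXIT TAIL FROM A DETERMINISTIC ACTION DROP** — the stub `stub_firstExitDeep` of cruxes stmt-QuantumFields-22884 ∕ 26243
BY SHAPE (constants `C = 1`, `N = 0`) from the purely variational statement: «for every first-exit event at height `2 ≤ j ≤ K` there is a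
`dU`-preserving map lowering the Wilson action by `c·p(g_{K−j})²/β_K` on it» (`β_K = (γε_K)⁻¹`; the admissible maps of §2 are the intended
witnesses).  This is what the Cameron–Martin mechanism reduces the stub to; the variational statement itself is NOT proved (see the module
doc-string for its range). [cite: Balaban1985UV3, (7) p.257 and (71) p.273] -/
theorem firstExitDeep_of_detActionDrop
    (hdet : ∀ (L : ℕ) (b₀ p₀ b₂ : ℝ), 0 < b₀ → 2 < p₀ → b₀ ≤ b₂ → ∃ (γ₁ c : ℝ), 0 < γ₁ ∧ γ₁ ≤ 1 ∧ 0 < c ∧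
      ∀ (F : T3Family) (γ : ℝ), F.L = L → 0 < γ → γ ≤ γ₁ → ∀ (K j : ℕ), 2 ≤ j → j ≤ K → ∀ p : Plaq (F.P K) j,
        ∃ Φ : GaugeField (F.P K) 0 (Matrix.specialUnitaryGroup (Fin 2) ℂ) →
            GaugeField (F.P K) 0 (Matrix.specialUnitaryGroup (Fin 2) ℂ),
          MeasurePreserving Φ (fieldMeasure (F.P K) 0 (Matrix.specialUnitaryGroup (Fin 2) ℂ))
            (fieldMeasure (F.P K) 0 (Matrix.specialUnitaryGroup (Fin 2) ℂ)) ∧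
          ∀ U ∈ {U : GaugeField (F.P K) 0 (Matrix.specialUnitaryGroup (Fin 2) ℂ) |
              (∀ k, k < j → PlaqSmall (θBal F.L γ b₀ p₀ (K - k))
                (Averaging.iter (fun i => BlockAveraging.blockAvg (P := F.P K) (j := i) ℰp) k U)) ∧
              PlaqSmall (θBal F.L γ b₂ p₀ (K - j)) (Averaging.iter (fun i => BlockAveraging.blockAvg (P := F.P K) (j := i) ℰp) j U) ∧
              θBal F.L γ b₀ p₀ (K - j) ≤ GaugeGroup.dist1 (GaugeField.plaqHol
                (Averaging.iter (fun i => BlockAveraging.blockAvg (P := F.P K) (j := i) ℰp) j U) p)},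
            wilsonAction4 (Φ U) + c * B10.pFun b₀ p₀ (Real.sqrt (γ * ((F.L : ℝ)⁻¹) ^ (K - j))) ^ 2 * (γ * (F.P K).eps) ≤
              wilsonAction4 U) :
    ∀ (L : ℕ) (b₀ p₀ b₂ : ℝ), 0 < b₀ → 2 < p₀ → b₀ ≤ b₂ → ∃ (γ₁ C c : ℝ) (N : ℕ), 0 < γ₁ ∧ γ₁ ≤ 1 ∧ 0 < c ∧ 0 ≤ C ∧
      ∀ (F : T3Family) (γ : ℝ), F.L = L → 0 < γ → γ ≤ γ₁ → ∀ (K j : ℕ), 2 ≤ j → j ≤ K → ∀ p : Plaq (F.P K) j,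
        (gibbsK F ℰp γ K).real {U | (∀ k, k < j → PlaqSmall (θBal F.L γ b₀ p₀ (K - k))
            (Averaging.iter (fun i => BlockAveraging.blockAvg (P := F.P K) (j := i) ℰp) k U)) ∧
          PlaqSmall (θBal F.L γ b₂ p₀ (K - j)) (Averaging.iter (fun i => BlockAveraging.blockAvg (P := F.P K) (j := i) ℰp) j U) ∧
          θBal F.L γ b₀ p₀ (K - j) ≤ GaugeGroup.dist1 (GaugeField.plaqHol
            (Averaging.iter (fun i => BlockAveraging.blockAvg (P := F.P K) (j := i) ℰp) j U) p)} ≤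
        C * ((γ * ((F.L : ℝ)⁻¹) ^ (K - j))⁻¹) ^ N *
          Real.exp (-(c * B10.pFun b₀ p₀ (Real.sqrt (γ * ((F.L : ℝ)⁻¹) ^ (K - j))) ^ 2)) := by
  intro L b₀ p₀ b₂ hb₀ hp₀ hb₂
  obtain ⟨γ₁, c, hγ₁, hγ₁1, hc, H⟩ := hdet L b₀ p₀ b₂ hb₀ hp₀ hb₂
  refine ⟨γ₁, 1, c, 0, hγ₁, hγ₁1, hc, zero_le_one, fun F γ hFL hγ hγle K j hj2 hjK p => ?_⟩
  obtain ⟨Φ, hΦ, hdrop⟩ := H F γ hFL hγ hγle K j hj2 hjK p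
  have h := gibbsK_real_le_exp_of_actionDrop F ℰp hγ.le K hΦ (measurableSet_firstExitEvent F γ b₀ p₀ b₂ K j p) hdrop
  have hβ : (F.scheme ℰp γ).β K = (γ * (F.P K).eps)⁻¹ := rfl
  have hne : γ * (F.P K).eps ≠ 0 := (mul_pos hγ (F.P K).eps_pos).ne'
  have hprod : (F.scheme ℰp γ).β K *
      (c * B10.pFun b₀ p₀ (Real.sqrt (γ * ((F.L : ℝ)⁻¹) ^ (K - j))) ^ 2 * (γ * (F.P K).eps)) =
        c * B10.pFun b₀ p₀ (Real.sqrt (γ * ((F.L : ℝ)⁻¹) ^ (K - j))) ^ 2 := by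
    rw [hβ, mul_comm, mul_assoc, mul_inv_cancel₀ hne, mul_one]
  rw [hprod] at h
  simpa only [one_mul, pow_zero] using h

end Stub

end Summit.QuantumFields.YangMills.Theorems.LargeFieldMassRefinementTailShiftBound
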